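import Mathlib.RepresentationTheory.Basic
import Mathlib.NumberTheory.LocalField.Basic
import Literature.NumberTheory.Automorphic.AdditiveCharacterDuality
import HarnessLib

/-!
# Twisted coinvariants of a smooth representation of the additive group of a local field

Let `F` be a non-archimedean local field, `ψ : F → 𝕊` a non-trivial continuous additive
character, and let the additive group `F` act on a complex vector space `V` through a
representation `ρ` of a group `G` and a one-parameter subgroup `e : F → G`
(`e (x + y) = e x * e y`), *smoothly*: every vector is fixed by `e` of a neighbourhood of `0`.
For `a ∈ F` write `ψ_a(x) = ψ(a x)` and
`V(ψ_a) = ⟨ρ(e x) v - ψ_a(x) v⟩` for the kernel of the projection onto the `ψ_a`-twisted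
coinvariants `V_{F, ψ_a} = V / V(ψ_a)`.

The main result of this file is the non-vanishing statement behind the theory of
Bernstein–Zelevinsky derivatives:

* `Literature.NumberTheory.Automorphic.TwistedJacquet.exists_twistedSpan_ne_top`: if `V ≠ 0`
  then `V_{F,ψ_a} ≠ 0` for some `a ∈ F` (possibly `a = 0`);
* `Literature.NumberTheory.Automorphic.TwistedJacquet.exists_sup_twistedSpan_ne_top`: the same
  relative to an `e(F)`-stable subspace `W ≠ V` (applied to `V / W`).

This is the statement "`Φ⁻(τ) = 0` and `Ψ⁻(τ) = 0` imply `τ = 0`" for the functors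
`Ψ⁻ = r_{V,1}`, `Φ⁻ = r_{V,θ}` of Bernstein–Zelevinsky (*Induced representations of reductive
`p`-adic groups I*, Ann. Sci. ÉNS 10 (1977), §3.2 Proposition (e) with Remark 3.3 (b): the
exact sequence `0 → Φ⁺Φ⁻ → Id → Ψ⁺Ψ⁻ → 0`), in the rank-one form in which it is proved in
Bernstein–Zelevinsky, *Representations of the group `GL(n, F)`* (Russian Math. Surveys 31
(1976)), §5.11–5.14 via the Jacquet–Langlands lemma 2.33, and, for `GL(2)`, in Bump,
*Automorphic forms and representations* (1997), Proposition 4.4.5 and the proof of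
Theorem 4.4.3 (PDF pp. 464–465: the stalks of the sheaf attached to a smooth `N(F)`-module are
the twisted Jacquet modules `J_{ψ_a}(V)`, and a cosmooth module all of whose stalks vanish is
zero).

## The printed argument, as formalised

Fix `v ≠ 0` and suppose `v ∈ V(ψ_a)` for every `a`. Let `S = s₁𝒪` be a lattice fixing `v`,
`k₀𝒪 ⊆ ker ψ` with `ψ` non-trivial on `(k₀/ϖ)𝒪` (level normalisation, from
`AddCharDuality.exists_mulShift_level_one`), and `A = (k₀/s₁)𝒪 ⊇ {a | ψ_a|_S = 1}`-ish the dual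
lattice. For a lattice `B = t𝒪 ⊇ S` and a transversal `R` of `B/S` put
`P_B(a) v = ∑_{r ∈ R} ψ(-a r) ρ(e r) v` (the integral `∫_B ψ_a(x)⁻¹ ρ(e x) v dx` of Jacquet's
lemma, Bump Prop. 4.4.1 / (4.21), as a finite sum).
1. (*Jacquet–Langlands lemma, easy half*) `v ∈ V(ψ_a)` implies `P_B(a) v = 0` for all large
   `B` (`twSum_eq_zero_of_mem_twistedSpan`): a generator `ρ(e x) w - ψ_a(x) w` is killed as
   soon as `x ∈ B`, by the change of variables `r ↦ r + x` in the transversal.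
2. `a ↦ P_B(a) v` is locally constant and `{a ∈ A | P_B(a) v = 0}` increases with `B`; by
   compactness of `A` one `B` works for every `a ∈ A`.
3. (*Fourier inversion on the finite group `A/B^⊥`*) `∑_{a ∈ A/B^⊥} P_B(a) v = #(A/B^⊥) · v`,
   because `∑_a ψ(-a r)` vanishes unless `r ∈ S` (a non-trivial character of a finite group
   sums to zero; non-triviality for `r ∉ S` is the separation property of the level
   normalisation). Hence `v = 0`, a contradiction.

Everything is phrased with lattices `ball s = {x | |x| ≤ |s|}` (`s ≠ 0`; Mathlib's
`Valuation.leAddSubgroup`), finite transversals (`IsTransversal`, obtained from compactness of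
`t𝒪` and openness of `s𝒪`) and finite sums; no Haar measure is used. The one-parameter subgroup
is an arbitrary map `e : F → G` with `e (x + y) = e x * e y` (rather than a
`Multiplicative F →* G`) because the applications supply it as `x ↦ 1 + x E_{i,t}`.

## References

* I. N. Bernstein, A. V. Zelevinsky, *Induced representations of reductive `p`-adic groups I*,
  Ann. Sci. ÉNS (4) 10 (1977), 441–472, §3.2–3.3 (`BernsteinZelevinskyASENS1977`; Numdam, open access, read).
* I. N. Bernstein, A. V. Zelevinsky, *Representations of the group `GL(n,F)` where `F` is a
  non-archimedean local field*, Russian Math. Surveys 31:3 (1976), 1–68, §2.33, §5.11–5.15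
  (`BernsteinZelevinskyRMS1976`; not held).
* D. Bump, *Automorphic forms and representations*, Cambridge (1997), §4.4, Propositions
  4.4.1, 4.4.5, Theorem 4.4.3 (PDF pp. 460–465) (`Bump1997`; held).
-/

open scoped BigOperators
open ValuativeRel

namespace Literature.NumberTheory.Automorphic

namespace TwistedJacquet

section Lattice

variable {F : Type*} [Field F] [ValuativeRel F]

/-! ### Lattices `s𝒪 = {x | |x| ≤ |s|}` -/

/-- The lattice `ball s = {x : F | |x| ≤ |s|}` (`= s𝒪[F]` for `s ≠ 0`), as an additive
subgroup of `F`: Mathlib's `Valuation.leAddSubgroup` of `valuation F` at the value `valuation F s`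
(parametrised by a generator `s` rather than by a value, which is how it is used below). [folklore] -/
noncomputable abbrev ball (s : F) : AddSubgroup F := (valuation F).leAddSubgroup (valuation F s)

/-- Membership in `ball s` (Mathlib `Valuation.mem_leAddSubgroup_iff`). [folklore] -/
@[simp] lemma mem_ball_iff {s x : F} : x ∈ ball s ↔ valuation F x ≤ valuation F s := Iff.rfl

/-- `s ∈ ball s`. [folklore] -/
lemma self_mem_ball (s : F) : s ∈ ball s := mem_ball_iff.2 le_rfl

/-- Lattices are nested according to the valuation of their generators
(Mathlib `Valuation.leAddSubgroup_monotone`). [folklore] -/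
lemma ball_mono {s t : F} (h : valuation F s ≤ valuation F t) : ball s ≤ ball t :=
  (valuation F).leAddSubgroup_monotone h

/-- `x ∈ ball s`, `y ∈ ball t` implies `x y ∈ ball (s t)`. [folklore] -/
lemma mul_mem_ball {s t x y : F} (hx : x ∈ ball s) (hy : y ∈ ball t) : x * y ∈ ball (s * t) := by
  simp only [mem_ball_iff, map_mul] at *
  exact mul_le_mul' hx hy

/-- Membership in `ball (k / s)` for `s ≠ 0`: `x ∈ ball (k/s) ↔ |x s| ≤ |k|`. [folklore] -/
lemma mem_ball_div_iff {k s x : F} (hs : s ≠ 0) :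
    x ∈ ball (k / s) ↔ valuation F (x * s) ≤ valuation F k := by
  rw [mem_ball_iff, map_div₀, map_mul, le_div_iff₀]
  exact lt_of_le_of_ne zero_le (Ne.symm ((map_ne_zero _).2 hs))

/-- Every element lies in some lattice `ball s`, `s ≠ 0`. [folklore] -/
lemma exists_mem_ball (x : F) : ∃ s : F, s ≠ 0 ∧ x ∈ ball s := by
  by_cases hx : x = 0
  · exact ⟨1, one_ne_zero, by simp [hx]⟩
  · exact ⟨x, hx, self_mem_ball x⟩

end Lattice

section Topology

variable {F : Type*} [Field F] [ValuativeRel F] [TopologicalSpace F] [IsNonarchimedeanLocalField F]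

/-- A lattice `ball s` with `s ≠ 0` is open. [folklore] -/
lemma isOpen_ball {s : F} (hs : s ≠ 0) : IsOpen (ball s : Set F) := by
  rw [isOpen_iff_mem_nhds]
  intro x hx
  rw [IsValuativeTopology.mem_nhds_iff']
  have hs' : valuation F s ≠ 0 := (map_ne_zero _).2 hs
  refine ⟨Units.mk0 _ hs', fun z hz => ?_⟩
  have hz' : valuation F (z - x) < valuation F s := hz
  have hx' : valuation F x ≤ valuation F s := hx
  have : z = (z - x) + x := by ring
  show valuation F z ≤ valuation F s
  rw [this]
  exact (Valuation.map_add (valuation F) _ _).trans (max_le hz'.le hx')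

/-- A lattice `ball s` is compact (Mathlib `IsNonarchimedeanLocalField.isCompact_closedBall`).
[folklore] -/
lemma isCompact_ball (s : F) : IsCompact (ball s : Set F) := by
  have : (ball s : Set F) = {x | valuation F x ≤ valuation F s} := rfl
  rw [this]
  exact IsNonarchimedeanLocalField.isCompact_closedBall F (valuation F s)

/-- Every neighbourhood of `0` contains a lattice `ball s`, `s ≠ 0`. [folklore] -/
lemma exists_ball_subset_of_mem_nhds {U : Set F} (hU : U ∈ nhds (0 : F)) :
    ∃ s : F, s ≠ 0 ∧ (ball s : Set F) ⊆ U := by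
  obtain ⟨γ, hγ⟩ := (IsValuativeTopology.mem_nhds_zero_iff U).1 hU
  obtain ⟨g, hg⟩ := ValuativeRel.valuation_surjective (γ : ValueGroupWithZero F)
  have hg0 : g ≠ 0 := by
    rintro rfl
    exact γ.ne_zero (by simpa using hg.symm)
  obtain ⟨ϖ, hϖ⟩ := IsDiscreteValuationRing.exists_irreducible 𝒪[F]
  refine ⟨g * ϖ, mul_ne_zero hg0 hϖ.coe_ne_zero, fun x hx => hγ ?_⟩
  have hx : valuation F x ≤ valuation F (g * (ϖ : F)) := (mem_ball_iff).1 hx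
  show valuation F x < γ
  refine lt_of_le_of_lt hx ?_
  rw [map_mul, hg]
  exact mul_lt_of_lt_one_right (zero_lt_iff.2 γ.ne_zero)
    (Valuation.integer.v_irreducible_lt_one hϖ)

/-- **Discreteness of the valuation**: there is `ϖ ≠ 0` with `|ϖ| < 1` such that every `z`
with `|z| < 1` satisfies `|z| ≤ |ϖ|` (a uniformizer). [folklore] -/
lemma exists_uniformizer :
    ∃ ϖ : F, ϖ ≠ 0 ∧ valuation F ϖ < 1 ∧ ∀ z : F, valuation F z < 1 → valuation F z ≤ valuation F ϖ := by
  obtain ⟨ϖ, hϖ⟩ := IsDiscreteValuationRing.exists_irreducible 𝒪[F]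
  refine ⟨ϖ, hϖ.coe_ne_zero, Valuation.integer.v_irreducible_lt_one hϖ, fun z hz => ?_⟩
  have hz1 : valuation F z ≤ 1 := hz.le
  set z' : 𝒪[F] := ⟨z, (Valuation.mem_integer_iff _ _).2 hz1⟩ with hz'_def
  have hzm : z' ∈ 𝓂[F] := by
    rw [IsLocalRing.mem_maximalIdeal, mem_nonunits_iff,
      (Valuation.integer.integers (valuation F)).isUnit_iff_valuation_eq_one]
    exact hz.ne
  rw [hϖ.maximalIdeal_eq, Ideal.mem_span_singleton'] at hzm
  obtain ⟨y, hy⟩ := hzm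
  have : z = (y : F) * (ϖ : F) := by
    have := congrArg Subtype.val hy
    simpa [hz'_def] using this.symm
  rw [this, map_mul]
  exact mul_le_of_le_one_left' ((Valuation.mem_integer_iff _ _).1 y.2)

end Topology

section Transversal

variable {F : Type*} [Field F]

/-! ### Finite transversals of `B / S` for lattices `S ≤ B` -/

/-- `R` is a **transversal** of `B` modulo `S`: a finite subset of `B` meeting every coset
`x + S`, `x ∈ B`, in exactly one point. [folklore] -/
structure IsTransversal (B S : AddSubgroup F) (R : Finset F) : Prop where
  /-- The representatives lie in `B`. -/
  mem_of_mem : ∀ r ∈ R, r ∈ B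
  /-- Every `x ∈ B` is congruent modulo `S` to exactly one representative. -/
  existsUnique : ∀ x ∈ B, ∃! r, r ∈ R ∧ x - r ∈ S

/-- **Existence of transversals**: if `S ≤ B` are additive subgroups of `F` with `S` open and
`B` compact, then `B / S` has a finite transversal (compactness gives finitely many cosets;
representatives are chosen with `Quotient.out`). [folklore] -/
theorem exists_isTransversal [TopologicalSpace F] [IsTopologicalAddGroup F] {B S : AddSubgroup F} (hSB : S ≤ B) (hS : IsOpen (S : Set F))
    (hB : IsCompact (B : Set F)) : ∃ R : Finset F, IsTransversal B S R := by
  classical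
  -- the open cover of `B` by the cosets `x + S`
  let U : F → Set F := fun x => {y | y - x ∈ S}
  have hUo : ∀ x, IsOpen (U x) := fun x => by
    have : U x = (fun y => y - x) ⁻¹' (S : Set F) := rfl
    rw [this]
    exact hS.preimage (continuous_sub_right x)
  have hcover : (B : Set F) ⊆ ⋃ x, U x := fun y _ => Set.mem_iUnion.2 ⟨y, by simp [U]⟩
  obtain ⟨T, hT⟩ := hB.elim_finite_subcover U hUo hcover
  -- representatives
  let q : F → F ⧸ S := QuotientAddGroup.mk
  let out : F → F := fun x => Quotient.out (q x)
  have hout : ∀ x, x - out x ∈ S := fun x => by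
    have h1 : q (out x) = q x := Quotient.out_eq _
    have := QuotientAddGroup.eq.1 h1
    -- this : -(out x) + x ∈ S
    simpa [sub_eq_add_neg, add_comm] using this
  refine ⟨(T.filter fun x => x ∈ B).image out, ⟨fun r hr => ?_, fun x hx => ?_⟩⟩
  · obtain ⟨x, hx, rfl⟩ := Finset.mem_image.1 hr
    have hxB : x ∈ B := (Finset.mem_filter.1 hx).2
    have : out x = x - (x - out x) := by ring
    rw [this]
    exact B.sub_mem hxB (hSB (hout x))
  · obtain ⟨x₀, hx₀T, hx₀⟩ : ∃ x₀ ∈ T, x ∈ U x₀ := by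
      have := hT hx
      simpa only [Set.mem_iUnion, exists_prop] using this
    have hx₀S : x - x₀ ∈ S := hx₀
    -- `x₀` may fail to lie in `B`; but `x₀ = x - (x - x₀)` does, since `S ≤ B`
    have hx₀B : x₀ ∈ B := by
      have : x₀ = x - (x - x₀) := by ring
      rw [this]
      exact B.sub_mem hx (hSB hx₀S)
    refine ⟨out x₀, ⟨Finset.mem_image.2 ⟨x₀, Finset.mem_filter.2 ⟨hx₀T, hx₀B⟩, rfl⟩, ?_⟩, ?_⟩
    · have : x - out x₀ = (x - x₀) + (x₀ - out x₀) := by ring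
      rw [this]
      exact S.add_mem hx₀S (hout x₀)
    · rintro r ⟨hr, hxr⟩
      obtain ⟨x₁, -, rfl⟩ := Finset.mem_image.1 hr
      -- `out x₁ ≡ x ≡ x₀`, hence `q x₁ = q x₀` and the representatives agree
      have h1 : q x₁ = q x₀ := by
        have e1 : q (out x₁) = q x₁ := Quotient.out_eq _
        have e0 : q (out x₀) = q x₀ := Quotient.out_eq _
        have e2 : q (out x₁) = q x := by
          refine QuotientAddGroup.eq.2 ?_
          have : -(out x₁) + x = x - out x₁ := by ring
          rw [this]; exact hxr
        have e3 : q x₀ = q x := by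
          refine QuotientAddGroup.eq.2 ?_
          have : -x₀ + x = x - x₀ := by ring
          rw [this]; exact hx₀S
        rw [← e1, e2, ← e3]
      change Quotient.out (q x₁) = Quotient.out (q x₀)
      rw [h1]

namespace IsTransversal

variable {B S : AddSubgroup F} {R : Finset F}

/-- The representative in `R` of the coset of `x ∈ B` (and `0` off `B`). [folklore] -/
noncomputable def rep (h : IsTransversal B S R) (x : F) : F :=
  by classical exact if hx : x ∈ B then Classical.choose (h.existsUnique x hx).exists else 0

/-- Defining property of `rep`. [folklore] -/
lemma rep_spec (h : IsTransversal B S R) {x : F} (hx : x ∈ B) :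
    h.rep x ∈ R ∧ x - h.rep x ∈ S := by
  classical
  simp only [rep, dif_pos hx]
  exact Classical.choose_spec (h.existsUnique x hx).exists

/-- The representative lies in `R`. [folklore] -/
lemma rep_mem (h : IsTransversal B S R) {x : F} (hx : x ∈ B) : h.rep x ∈ R := (h.rep_spec hx).1

/-- `x - rep x ∈ S`. [folklore] -/
lemma sub_rep_mem (h : IsTransversal B S R) {x : F} (hx : x ∈ B) : x - h.rep x ∈ S :=
  (h.rep_spec hx).2

/-- The representative lies in `B`. [folklore] -/
lemma rep_mem_B (h : IsTransversal B S R) {x : F} (hx : x ∈ B) : h.rep x ∈ B :=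
  h.mem_of_mem _ (h.rep_mem hx)

/-- Uniqueness of representatives: if `r ∈ R` and `x - r ∈ S` then `rep x = r`. [folklore] -/
lemma rep_eq_of (h : IsTransversal B S R) {x r : F} (hx : x ∈ B) (hr : r ∈ R) (hxr : x - r ∈ S) :
    h.rep x = r :=
  (h.existsUnique x hx).unique (h.rep_spec hx) ⟨hr, hxr⟩

/-- Elements of `R` are their own representatives. [folklore] -/
lemma rep_self (h : IsTransversal B S R) {r : F} (hr : r ∈ R) : h.rep r = r :=
  h.rep_eq_of (h.mem_of_mem r hr) hr (by simp)

/-- `rep (x + s) = rep x` for `s ∈ S` (`S ≤ B`). [folklore] -/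
lemma rep_add_of_mem (h : IsTransversal B S R) (hSB : S ≤ B) {x s : F} (hx : x ∈ B) (hs : s ∈ S) :
    h.rep (x + s) = h.rep x := by
  refine h.rep_eq_of (B.add_mem hx (hSB hs)) (h.rep_mem hx) ?_
  have : x + s - h.rep x = (x - h.rep x) + s := by ring
  rw [this]
  exact S.add_mem (h.sub_rep_mem hx) hs

/-- A transversal of a subgroup containing `0`... is non-empty: it contains `rep 0`. [folklore] -/
lemma nonempty (h : IsTransversal B S R) : R.Nonempty := ⟨h.rep 0, h.rep_mem B.zero_mem⟩

/-- The representative of `0` lies in `S`. [folklore] -/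
lemma rep_zero_mem (h : IsTransversal B S R) : h.rep 0 ∈ S := by
  have := h.sub_rep_mem B.zero_mem
  rwa [zero_sub, neg_mem_iff] at this

/-- An element of `R` lying in `S` is `rep 0`. [folklore] -/
lemma eq_rep_zero_of_mem (h : IsTransversal B S R) {r : F} (hr : r ∈ R) (hrS : r ∈ S) :
    r = h.rep 0 :=
  (h.rep_eq_of B.zero_mem hr (by simpa using hrS)).symm

/-! ### Sums over transversals -/

variable {M : Type*} [AddCommMonoid M]

/-- **Translation invariance**: for an `S`-periodic `f` on `B` and `x₀ ∈ B`,
`∑_{r ∈ R} f (r + x₀) = ∑_{r ∈ R} f r` (the change of variables in Jacquet's lemma,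
Bump 1997, proof of Prop. 4.4.1). [cite: Bump1997, Proposition 4.4.1 (PDF p. 460)] -/
theorem sum_add_right (h : IsTransversal B S R) (f : F → M)
    (hf : ∀ x ∈ B, ∀ s ∈ S, f (x + s) = f x) {x₀ : F} (hx₀ : x₀ ∈ B) :
    ∑ r ∈ R, f (r + x₀) = ∑ r ∈ R, f r := by
  refine Finset.sum_nbij' (fun r => h.rep (r + x₀)) (fun r => h.rep (r - x₀)) ?_ ?_ ?_ ?_ ?_
  · intro r hr
    exact h.rep_mem (B.add_mem (h.mem_of_mem r hr) hx₀)
  · intro r hr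
    exact h.rep_mem (B.sub_mem (h.mem_of_mem r hr) hx₀)
  · intro r hr
    have hrB := h.mem_of_mem r hr
    have h1 : r + x₀ ∈ B := B.add_mem hrB hx₀
    -- rep (r + x₀) = r + x₀ - s, so rep (r + x₀) - x₀ = r - s
    refine h.rep_eq_of (B.sub_mem (h.rep_mem_B h1) hx₀) hr ?_
    have : h.rep (r + x₀) - x₀ - r = -(r + x₀ - h.rep (r + x₀)) := by ring
    rw [this]
    exact S.neg_mem (h.sub_rep_mem h1)
  · intro r hr
    have hrB := h.mem_of_mem r hr
    have h1 : r - x₀ ∈ B := B.sub_mem hrB hx₀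
    refine h.rep_eq_of (B.add_mem (h.rep_mem_B h1) hx₀) hr ?_
    have : h.rep (r - x₀) + x₀ - r = -(r - x₀ - h.rep (r - x₀)) := by ring
    rw [this]
    exact S.neg_mem (h.sub_rep_mem h1)
  · intro r hr
    have h1 : r + x₀ ∈ B := B.add_mem (h.mem_of_mem r hr) hx₀
    have : r + x₀ = h.rep (r + x₀) + (r + x₀ - h.rep (r + x₀)) := by ring
    conv_lhs => rw [this]
    exact hf _ (h.rep_mem_B h1) _ (h.sub_rep_mem h1)

/-- **Two transversals give the same sum** of an `S`-periodic function. [folklore] -/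
theorem sum_eq_sum_of_isTransversal (h : IsTransversal B S R) {R' : Finset F}
    (h' : IsTransversal B S R') (f : F → M) (hf : ∀ x ∈ B, ∀ s ∈ S, f (x + s) = f x) :
    ∑ r ∈ R, f r = ∑ r ∈ R', f r := by
  refine Finset.sum_nbij' (fun r => h'.rep r) (fun r => h.rep r) ?_ ?_ ?_ ?_ ?_
  · exact fun r hr => h'.rep_mem (h.mem_of_mem r hr)
  · exact fun r hr => h.rep_mem (h'.mem_of_mem r hr)
  · intro r hr
    have hrB := h.mem_of_mem r hr
    refine h.rep_eq_of (h'.rep_mem_B hrB) hr ?_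
    have : h'.rep r - r = -(r - h'.rep r) := by ring
    rw [this]; exact S.neg_mem (h'.sub_rep_mem hrB)
  · intro r hr
    have hrB := h'.mem_of_mem r hr
    refine h'.rep_eq_of (h.rep_mem_B hrB) hr ?_
    have : h.rep r - r = -(r - h.rep r) := by ring
    rw [this]; exact S.neg_mem (h.sub_rep_mem hrB)
  · intro r hr
    have hrB := h.mem_of_mem r hr
    have : r = h'.rep r + (r - h'.rep r) := by ring
    conv_lhs => rw [this]
    exact hf _ (h'.rep_mem_B hrB) _ (h'.sub_rep_mem hrB)

/-- **Summation in stages**: for `S ≤ B' ≤ B`, transversals `R` of `B/S`, `R'` of `B/B'` and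
`R''` of `B'/S`, and an `S`-periodic `f`,
`∑_{r ∈ R} f r = ∑_{r' ∈ R'} ∑_{r'' ∈ R''} f (r' + r'')`. [folklore] -/
theorem sum_eq_sum_sum {B' : AddSubgroup F} {R' R'' : Finset F} (h : IsTransversal B S R)
    (h' : IsTransversal B B' R') (h'' : IsTransversal B' S R'') (hB'B : B' ≤ B) (hSB' : S ≤ B')
    (f : F → M) (hf : ∀ x ∈ B, ∀ s ∈ S, f (x + s) = f x) :
    ∑ r ∈ R, f r = ∑ r' ∈ R', ∑ r'' ∈ R'', f (r' + r'') := by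
  rw [← Finset.sum_product']
  symm
  refine Finset.sum_nbij' (fun p => h.rep (p.1 + p.2))
    (fun r => (h'.rep r, h''.rep (r - h'.rep r))) ?_ ?_ ?_ ?_ ?_
  · rintro ⟨p₁, p₂⟩ hp
    rw [Finset.mem_product] at hp
    exact h.rep_mem (B.add_mem (h'.mem_of_mem _ hp.1) (hB'B (h''.mem_of_mem _ hp.2)))
  · intro r hr
    have hrB := h.mem_of_mem r hr
    rw [Finset.mem_product]
    exact ⟨h'.rep_mem hrB, h''.rep_mem (h'.sub_rep_mem hrB)⟩
  · rintro ⟨p₁, p₂⟩ hp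
    rw [Finset.mem_product] at hp
    have hp₁B := h'.mem_of_mem _ hp.1
    have hp₂B' := h''.mem_of_mem _ hp.2
    have hsum : p₁ + p₂ ∈ B := B.add_mem hp₁B (hB'B hp₂B')
    set r := h.rep (p₁ + p₂) with hr_def
    have hs : p₁ + p₂ - r ∈ S := h.sub_rep_mem hsum
    have hrB : r ∈ B := h.rep_mem_B hsum
    have e1 : h'.rep r = p₁ := by
      refine h'.rep_eq_of hrB hp.1 ?_
      have : r - p₁ = p₂ - (p₁ + p₂ - r) := by ring
      rw [this]
      exact B'.sub_mem hp₂B' (hSB' hs)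
    have e2 : h''.rep (r - h'.rep r) = p₂ := by
      rw [e1]
      have hmem : r - p₁ ∈ B' := by
        have : r - p₁ = p₂ - (p₁ + p₂ - r) := by ring
        rw [this]; exact B'.sub_mem hp₂B' (hSB' hs)
      refine h''.rep_eq_of hmem hp.2 ?_
      have : r - p₁ - p₂ = -(p₁ + p₂ - r) := by ring
      rw [this]; exact S.neg_mem hs
    exact Prod.ext e1 e2
  · intro r hr
    have hrB := h.mem_of_mem r hr
    have h1 : r - h'.rep r ∈ B' := h'.sub_rep_mem hrB
    have h2 : r - h'.rep r - h''.rep (r - h'.rep r) ∈ S := h''.sub_rep_mem h1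
    change h.rep (h'.rep r + h''.rep (r - h'.rep r)) = r
    refine h.rep_eq_of (B.add_mem (h'.rep_mem_B hrB) (hB'B (h''.rep_mem_B h1))) hr ?_
    have : h'.rep r + h''.rep (r - h'.rep r) - r = -(r - h'.rep r - h''.rep (r - h'.rep r)) := by
      ring
    rw [this]; exact S.neg_mem h2
  · rintro ⟨p₁, p₂⟩ hp
    rw [Finset.mem_product] at hp
    have hsum : p₁ + p₂ ∈ B := B.add_mem (h'.mem_of_mem _ hp.1) (hB'B (h''.mem_of_mem _ hp.2))
    change f (p₁ + p₂) = f (h.rep (p₁ + p₂))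
    have : p₁ + p₂ = h.rep (p₁ + p₂) + (p₁ + p₂ - h.rep (p₁ + p₂)) := by ring
    conv_lhs => rw [this]
    exact hf _ (h.rep_mem_B hsum) _ (h.sub_rep_mem hsum)

/-- The sum over a transversal of `B/S` of a `B`-periodic function is `#R • f 0`-like:
all terms are equal. [folklore] -/
theorem sum_eq_card_smul (R : Finset F) (f : F → M) (x : F)
    (hf : ∀ r ∈ R, f (x + r) = f x) : ∑ r ∈ R, f (x + r) = R.card • f x := by
  rw [Finset.sum_congr rfl hf, Finset.sum_const]

end IsTransversal

end Transversal

/-! ### Level normalisation of `ψ` and the separation property -/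

section Level

variable {F : Type*} [Field F] [ValuativeRel F] [TopologicalSpace F] [IsNonarchimedeanLocalField F]

/-- An element of valuation `< 1` lies in the maximal ideal of `𝒪[F]`. [folklore] -/
lemma mem_maximalIdeal_of_lt_one {z : F} (hz : valuation F z < 1) :
    (⟨z, (Valuation.mem_integer_iff _ _).2 hz.le⟩ : 𝒪[F]) ∈ 𝓂[F] := by
  rw [IsLocalRing.mem_maximalIdeal, mem_nonunits_iff,
    (Valuation.integer.integers (valuation F)).isUnit_iff_valuation_eq_one]
  exact hz.ne

omit [TopologicalSpace F] [IsNonarchimedeanLocalField F] in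
/-- If `s ≠ 0` and `|s| ≤ |t|` then `t ≠ 0`. [folklore] -/
lemma ne_zero_of_valuation_le {s t : F} (hs : s ≠ 0) (h : valuation F s ≤ valuation F t) : t ≠ 0 := by
  rintro rfl
  rw [map_zero, le_zero_iff, map_eq_zero] at h
  exact hs h

omit [TopologicalSpace F] [IsNonarchimedeanLocalField F] in
/-- Two non-zero elements have a common "upper bound" lattice generator. [folklore] -/
lemma exists_valuation_ge_ge (t₀ s₁ : F) (hs₁ : s₁ ≠ 0) :
    ∃ t : F, t ≠ 0 ∧ valuation F t₀ ≤ valuation F t ∧ valuation F s₁ ≤ valuation F t := by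
  by_cases h : valuation F t₀ ≤ valuation F s₁
  · exact ⟨s₁, hs₁, h, le_rfl⟩
  · exact ⟨t₀, ne_zero_of_valuation_le hs₁ (le_of_not_ge h), le_rfl, le_of_not_ge h⟩

omit [TopologicalSpace F] [IsNonarchimedeanLocalField F] in
/-- Two non-zero elements have a common "lower bound" lattice generator. [folklore] -/
lemma exists_valuation_le_le (s s' : F) (hs : s ≠ 0) (hs' : s' ≠ 0) :
    ∃ u : F, u ≠ 0 ∧ valuation F u ≤ valuation F s ∧ valuation F u ≤ valuation F s' := by
  by_cases h : valuation F s ≤ valuation F s'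
  · exact ⟨s, hs, le_rfl, h⟩
  · exact ⟨s', hs', le_of_not_ge h, le_rfl⟩

/-- **Level data** for a non-trivial continuous `ψ` (Bushnell–Henniart §1.7; Bump 1997,
Exercise 3.1.1 (b)): there is `k₀ ≠ 0` such that `ψ` is trivial on the lattice `k₀𝒪`, and
with the *separation property*: whenever `|s| < |x|` (`s ≠ 0`) there is `a₀` with `a₀ s ∈ k₀𝒪`
(so that `ψ(a₀ ·)` is trivial on `s𝒪`) but `ψ(a₀ x) ≠ 1`. Obtained from the level-one
normalisation `AddCharDuality.exists_mulShift_level_one` (`k₀ = t ϖ`) and the discreteness of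
the valuation. [cite: Bump1997, Exercise 3.1.1 (b) (PDF p. 266)] -/
theorem exists_level {ψ : AddChar F Circle} (hψ : ψ.IsContinuousNontrivial) :
    ∃ k₀ : F, k₀ ≠ 0 ∧ (∀ x ∈ ball k₀, ψ x = 1) ∧
      ∀ x s : F, s ≠ 0 → valuation F s < valuation F x →
        ∃ a₀ : F, valuation F (a₀ * s) ≤ valuation F k₀ ∧ ψ (a₀ * x) ≠ 1 := by
  obtain ⟨ϖ', hϖ'⟩ := IsDiscreteValuationRing.exists_irreducible 𝒪[F]
  obtain ⟨t, ht0, htriv, y₁, hy₁⟩ := AddCharDuality.exists_mulShift_level_one hϖ' hψ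
  obtain ⟨ϖ, hϖ0, hϖ1, hdisc⟩ := exists_uniformizer (F := F)
  have ht' : 0 < valuation F t := zero_lt_iff.2 ((map_ne_zero _).2 ht0)
  refine ⟨t * ϖ, mul_ne_zero ht0 hϖ0, ?_, ?_⟩
  · intro x hx
    rw [mem_ball_iff, map_mul] at hx
    have hxt : valuation F (x / t) < 1 := by
      rw [map_div₀, div_lt_one₀ ht']
      refine lt_of_le_of_lt hx ?_
      calc valuation F t * valuation F ϖ < valuation F t * 1 :=
            mul_lt_mul_of_pos_left hϖ1 ht'
        _ = valuation F t := mul_one _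
    have h1 := htriv ⟨x / t, (Valuation.mem_integer_iff _ _).2 hxt.le⟩ (mem_maximalIdeal_of_lt_one hxt)
    rw [AddChar.mulShift_apply] at h1
    have : t * (x / t) = x := mul_div_cancel₀ x ht0
    simpa [this] using h1
  · intro x s hs hsx
    have hx0 : x ≠ 0 := by
      rintro rfl
      rw [map_zero] at hsx
      exact not_lt_zero hsx
    have hx' : 0 < valuation F x := zero_lt_iff.2 ((map_ne_zero _).2 hx0)
    have hsx' : valuation F (s / x) ≤ valuation F ϖ := by
      apply hdisc
      rwa [map_div₀, div_lt_one₀ hx']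
    refine ⟨t * (y₁ : F) / x, ?_, ?_⟩
    · have : t * (y₁ : F) / x * s = (t * (y₁ : F)) * (s / x) := by
        field_simp
      rw [this, map_mul, map_mul, map_mul]
      calc valuation F t * valuation F (y₁ : F) * valuation F (s / x)
          ≤ valuation F t * 1 * valuation F ϖ :=
            mul_le_mul' (mul_le_mul' le_rfl ((Valuation.mem_integer_iff _ _).1 y₁.2)) hsx'
        _ = valuation F t * valuation F ϖ := by rw [mul_one]
    · have : t * (y₁ : F) / x * x = t * (y₁ : F) := div_mul_cancel₀ _ hx0
      rw [this]
      rwa [AddChar.mulShift_apply] at hy₁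

end Level

/-! ### Smooth one-parameter actions and the averaging sums `P_B(a)` -/

section Rep

variable {F : Type*} [Field F] [ValuativeRel F] [TopologicalSpace F] [IsNonarchimedeanLocalField F]
variable {G V : Type*} [Group G] [AddCommGroup V] [Module ℂ V]
  (ρ : Representation ℂ G V) (e : F → G) (ψ : AddChar F Circle)

/-- The kernel `V(ψ_a) = ⟨ρ(e x) v - ψ(a x) v : x ∈ F, v ∈ V⟩` of the projection of `V` onto
its `ψ_a`-**twisted coinvariants** under the one-parameter subgroup `e` (Bump 1997, §4.4,
`V_{N,ψ}` before Prop. 4.4.3 (PDF p. 462); Bernstein–Zelevinsky 1977, §1.8, `r_{V,θ}`). [cite: Bump1997, §4.4 (PDF p. 462)] -/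
def twistedSpan (a : F) : Submodule ℂ V :=
  Submodule.span ℂ {w | ∃ (x : F) (v : V), w = ρ (e x) v - (ψ (a * x) : ℂ) • v}

omit [ValuativeRel F] [TopologicalSpace F] [IsNonarchimedeanLocalField F] in
/-- Generators of `twistedSpan`. [folklore] -/
lemma sub_smul_mem_twistedSpan (a x : F) (v : V) :
    ρ (e x) v - (ψ (a * x) : ℂ) • v ∈ twistedSpan ρ e ψ a :=
  Submodule.subset_span ⟨x, v, rfl⟩

/-- The **averaging operator** `P(a, R) = ∑_{r ∈ R} ψ(-a r) ρ(e r)` over a finite set `R`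
(a transversal of `B/S` in applications): the finite-sum form of `∫_B ψ_a(x)⁻¹ ρ(e x) · dx` of
Jacquet's lemma (Bump 1997, (4.21), PDF p. 462). [cite: Bump1997, Proposition 4.4.3, (4.21) (PDF p. 462)] -/
noncomputable def twSum (a : F) (R : Finset F) : V →ₗ[ℂ] V :=
  ∑ r ∈ R, (ψ (-(a * r)) : ℂ) • ρ (e r)

omit [ValuativeRel F] [TopologicalSpace F] [IsNonarchimedeanLocalField F] in
/-- Unfolding lemma for `twSum`. [folklore] -/
lemma twSum_apply (a : F) (R : Finset F) (v : V) :
    twSum ρ e ψ a R v = ∑ r ∈ R, (ψ (-(a * r)) : ℂ) • ρ (e r) v := by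
  simp [twSum, LinearMap.sum_apply, LinearMap.smul_apply]

omit [ValuativeRel F] [TopologicalSpace F] [IsNonarchimedeanLocalField F] in
/-- `ψ(x + y) = ψ x ψ y` in `ℂ`. [folklore] -/
lemma coe_map_add (x y : F) : ((ψ (x + y) : Circle) : ℂ) = ψ x * ψ y := by
  rw [AddChar.map_add_eq_mul, Circle.coe_mul]

omit [ValuativeRel F] [TopologicalSpace F] [IsNonarchimedeanLocalField F] in
/-- `ψ(a x) ψ(-(a x)) = 1` in `ℂ`. [folklore] -/
lemma coe_mul_coe_neg (z : F) : ((ψ z : Circle) : ℂ) * ψ (-z) = 1 := by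
  rw [AddChar.map_neg_eq_inv, Circle.coe_inv, mul_inv_cancel₀ (Circle.coe_ne_zero _)]

variable {ρ e}

omit [ValuativeRel F] [TopologicalSpace F] [IsNonarchimedeanLocalField F] in
/-- A one-parameter subgroup composes additively under `ρ`. [folklore] -/
lemma apply_e_add (he : ∀ x y, e (x + y) = e x * e y) (x y : F) (v : V) :
    ρ (e (x + y)) v = ρ (e x) (ρ (e y) v) := by
  rw [he, map_mul, Module.End.mul_apply]

variable {ψ}

omit [TopologicalSpace F] [IsNonarchimedeanLocalField F] in
/-- If `a s₁ ∈ k₀𝒪 ⊆ ker ψ` then `ψ(a ·)` is trivial on `s₁𝒪`. [folklore] -/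
lemma apply_mul_eq_one_of_mem_ball {k₀ s₁ a : F} (hker : ∀ x ∈ ball k₀, ψ x = 1)
    (ha : valuation F (a * s₁) ≤ valuation F k₀) {y : F} (hy : y ∈ ball s₁) : ψ (a * y) = 1 := by
  apply hker
  rw [mem_ball_iff, map_mul]
  rw [map_mul] at ha
  exact le_trans (mul_le_mul' le_rfl hy) ha

omit [TopologicalSpace F] [IsNonarchimedeanLocalField F] in
/-- **Periodicity** of the summand `y ↦ ψ(-a y) ρ(e y) v` modulo a lattice fixing `v` on
which `ψ(a ·)` is trivial. [folklore] -/
lemma summand_periodic (he : ∀ x y, e (x + y) = e x * e y) {a s' : F} {v : V}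
    (hk : ∀ y ∈ ball s', ψ (a * y) = 1) (hv : ∀ y ∈ ball s', ρ (e y) v = v)
    (y : F) {s : F} (hs : s ∈ ball s') :
    (ψ (-(a * (y + s))) : ℂ) • ρ (e (y + s)) v = (ψ (-(a * y)) : ℂ) • ρ (e y) v := by
  rw [apply_e_add he, hv s hs]
  have : -(a * (y + s)) = -(a * y) + -(a * s) := by ring
  rw [this, coe_map_add, AddChar.map_neg_eq_inv ψ (a * s), hk s hs, inv_one, Circle.coe_one,
    mul_one]

omit [TopologicalSpace F] [IsNonarchimedeanLocalField F] in
/-- **The easy half of Jacquet's lemma, for a generator** (Bump 1997, proof of Prop. 4.4.1,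
PDF p. 460): if `x ∈ B` then `P(a,R)` kills `ρ(e x) w - ψ(a x) w` for every transversal `R`
of `B / s'𝒪`, where `s'𝒪` fixes `w` and `ψ(a ·)|_{s'𝒪} = 1` (change of variables `r ↦ r + x`). [cite: Bump1997, Proposition 4.4.1 (PDF p. 460)] -/
theorem twSum_generator (he : ∀ x y, e (x + y) = e x * e y) {a t s' : F}
    (hk : ∀ y ∈ ball s', ψ (a * y) = 1) {R : Finset F} (hR : IsTransversal (ball t) (ball s') R)
    {x : F} (hx : x ∈ ball t) {w : V} (hw : ∀ y ∈ ball s', ρ (e y) w = w) :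
    twSum ρ e ψ a R (ρ (e x) w - (ψ (a * x) : ℂ) • w) = 0 := by
  rw [map_sub, map_smul, twSum_apply, twSum_apply, sub_eq_zero]
  let f : F → V := fun y => (ψ (-(a * y)) : ℂ) • ρ (e y) w
  have hf : ∀ y ∈ ball t, ∀ s ∈ ball s', f (y + s) = f y := fun y _ s hs =>
    summand_periodic he hk hw y hs
  have key := hR.sum_add_right f hf hx
  calc ∑ r ∈ R, (ψ (-(a * r)) : ℂ) • ρ (e r) (ρ (e x) w)
      = ∑ r ∈ R, (ψ (a * x) : ℂ) • f (r + x) := by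
        refine Finset.sum_congr rfl fun r _ => ?_
        simp only [f]
        rw [← apply_e_add he, smul_smul]
        congr 1
        have : -(a * (r + x)) = -(a * r) + -(a * x) := by ring
        rw [this, coe_map_add, mul_left_comm, coe_mul_coe_neg, mul_one]
    _ = (ψ (a * x) : ℂ) • ∑ r ∈ R, f (r + x) := by rw [Finset.smul_sum]
    _ = (ψ (a * x) : ℂ) • ∑ r ∈ R, f r := by rw [key]

omit [TopologicalSpace F] [IsNonarchimedeanLocalField F] in
/-- **Local constancy in `a`**: `P(a', R) = P(a, R)` if `a' - a ∈ (k₀/t)𝒪`, `R ⊆ t𝒪` and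
`k₀𝒪 ⊆ ker ψ`. [folklore] -/
theorem twSum_congr_of_sub_mem {a a' t k₀ : F} (hker : ∀ x ∈ ball k₀, ψ x = 1) (ht : t ≠ 0)
    {R : Finset F} (hR : ∀ r ∈ R, r ∈ ball t) (h : a' - a ∈ ball (k₀ / t)) :
    twSum ρ e ψ a' R = twSum ρ e ψ a R := by
  unfold twSum
  refine Finset.sum_congr rfl fun r hr => ?_
  congr 2
  have e1 : -(a' * r) = -(a * r) + -((a' - a) * r) := by ring
  have hmem : -((a' - a) * r) ∈ ball k₀ := by
    rw [neg_mem_iff]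
    have := mul_mem_ball h (hR r hr)
    rwa [div_mul_cancel₀ k₀ ht] at this
  rw [e1, AddChar.map_add_eq_mul, hker _ hmem, mul_one]

/-- **Monotonicity in the lattice**: if `P_B(a) v = 0` for `B = t𝒪` then `P_{B'}(a) v = 0` for
every larger lattice `B' = t'𝒪` (summation in stages over `B'/B`). [folklore] -/
theorem twSum_eq_zero_mono (he : ∀ x y, e (x + y) = e x * e y) {a s₁ t t' : F} {v : V}
    (hs₁ : s₁ ≠ 0) (hvfix : ∀ y ∈ ball s₁, ρ (e y) v = v) (haS : ∀ y ∈ ball s₁, ψ (a * y) = 1)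
    (hst : valuation F s₁ ≤ valuation F t) (htt' : valuation F t ≤ valuation F t')
    {R R' : Finset F} (hR : IsTransversal (ball t) (ball s₁) R)
    (hR' : IsTransversal (ball t') (ball s₁) R') (h0 : twSum ρ e ψ a R v = 0) :
    twSum ρ e ψ a R' v = 0 := by
  have ht : t ≠ 0 := ne_zero_of_valuation_le hs₁ hst
  obtain ⟨R₁, hR₁⟩ := exists_isTransversal (B := ball t') (S := ball t) (ball_mono htt')
    (isOpen_ball ht) (isCompact_ball t')
  let f : F → V := fun y => (ψ (-(a * y)) : ℂ) • ρ (e y) v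
  have hf : ∀ y ∈ ball t', ∀ s ∈ ball s₁, f (y + s) = f y := fun y _ s hs =>
    summand_periodic he haS hvfix y hs
  rw [twSum_apply]
  change ∑ r ∈ R', f r = 0
  rw [hR'.sum_eq_sum_sum hR₁ hR (ball_mono htt') (ball_mono hst) f hf]
  refine Finset.sum_eq_zero fun r₁ _ => ?_
  have hinner : ∑ r ∈ R, f (r₁ + r) = (ψ (-(a * r₁)) : ℂ) • ρ (e r₁) (twSum ρ e ψ a R v) := by
    rw [twSum_apply, map_sum, Finset.smul_sum]
    refine Finset.sum_congr rfl fun r _ => ?_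
    simp only [f]
    rw [apply_e_add he, map_smul, smul_smul]
    congr 1
    have : -(a * (r₁ + r)) = -(a * r₁) + -(a * r) := by ring
    rw [this, coe_map_add]
  rw [hinner, h0, map_zero, smul_zero]

omit [TopologicalSpace F] [IsNonarchimedeanLocalField F] in
/-- **Fourier inversion** for the family `ψ_a`, `a ∈ A/(k₀/t)𝒪` with `A = (k₀/s₁)𝒪`:
`∑_{a ∈ D} P_B(a) v = #D · v` for `v` fixed by `S = s₁𝒪`, `B = t𝒪 ⊇ S`, `D` a transversal of
`A / (k₀/t)𝒪`. The character sum `∑_{a ∈ D} ψ(-a r)` equals `#D` for `r ∈ S` and vanishes for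
`r ∉ S` (translation by the `a₀` of the separation property). [folklore] -/
theorem sum_twSum_eq_card_smul {k₀ s₁ t : F}
    (hs₁ : s₁ ≠ 0) (ht : t ≠ 0) (hker : ∀ x ∈ ball k₀, ψ x = 1)
    (hsep : ∀ x s : F, s ≠ 0 → valuation F s < valuation F x →
      ∃ a₀ : F, valuation F (a₀ * s) ≤ valuation F k₀ ∧ ψ (a₀ * x) ≠ 1)
    {v : V} (hvfix : ∀ y ∈ ball s₁, ρ (e y) v = v)
    {R : Finset F} (hR : IsTransversal (ball t) (ball s₁) R)
    {D : Finset F} (hD : IsTransversal (ball (k₀ / s₁)) (ball (k₀ / t)) D) :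
    ∑ a ∈ D, twSum ρ e ψ a R v = D.card • v := by
  set r₀ := hR.rep 0 with hr₀_def
  have hr₀R : r₀ ∈ R := hR.rep_mem (ball t).zero_mem
  have hr₀S : r₀ ∈ ball s₁ := hR.rep_zero_mem
  -- the character sums
  have hchar_zero : ∀ r ∈ R, r ≠ r₀ → ∑ a ∈ D, ((ψ (-(a * r)) : Circle) : ℂ) = 0 := by
    intro r hr hne
    have hrS : r ∉ ball s₁ := fun h => hne (hR.eq_rep_zero_of_mem hr h)
    have hlt : valuation F s₁ < valuation F (-r) := by
      rw [Valuation.map_neg]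
      exact lt_of_not_ge (fun h => hrS h)
    obtain ⟨a₀, ha₀, hne1⟩ := hsep (-r) s₁ hs₁ hlt
    have ha₀A : a₀ ∈ ball (k₀ / s₁) := (mem_ball_div_iff hs₁).2 ha₀
    let g : F → ℂ := fun a => ((ψ (-(a * r)) : Circle) : ℂ)
    have hrt : r ∈ ball t := hR.mem_of_mem r hr
    have hg : ∀ a ∈ ball (k₀ / s₁), ∀ b ∈ ball (k₀ / t), g (a + b) = g a := by
      intro a _ b hb
      simp only [g]
      have e1 : -((a + b) * r) = -(a * r) + -(b * r) := by ring
      have hbr : -(b * r) ∈ ball k₀ := by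
        rw [neg_mem_iff]
        have := mul_mem_ball hb hrt
        rwa [div_mul_cancel₀ k₀ ht] at this
      rw [e1, AddChar.map_add_eq_mul, hker _ hbr, mul_one]
    have key := hD.sum_add_right g hg ha₀A
    have key2 : ∑ a ∈ D, g (a + a₀) = (∑ a ∈ D, g a) * ψ (a₀ * -r) := by
      rw [Finset.sum_mul]
      refine Finset.sum_congr rfl fun a _ => ?_
      simp only [g]
      have e1 : -((a + a₀) * r) = -(a * r) + a₀ * -r := by ring
      rw [e1, coe_map_add]
    rw [key2] at key
    -- (∑ g) * c = ∑ g with c ≠ 1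
    have hc : ((ψ (a₀ * -r) : Circle) : ℂ) ≠ 1 := by
      intro h
      apply hne1
      ext
      rw [h, Circle.coe_one]
    have := sub_eq_zero.2 key
    rw [← mul_sub_one] at this
    exact (mul_eq_zero.1 this).resolve_right (sub_ne_zero.2 hc)
  have hchar_r₀ : ∑ a ∈ D, ((ψ (-(a * r₀)) : Circle) : ℂ) = D.card := by
    rw [Finset.card_eq_sum_ones, Nat.cast_sum, Nat.cast_one]
    refine Finset.sum_congr rfl fun a ha => ?_
    have haA : a ∈ ball (k₀ / s₁) := hD.mem_of_mem a ha
    have : -(a * r₀) ∈ ball k₀ := by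
      rw [neg_mem_iff]
      have := mul_mem_ball haA hr₀S
      rwa [div_mul_cancel₀ k₀ hs₁] at this
    rw [hker _ this, Circle.coe_one]
  calc ∑ a ∈ D, twSum ρ e ψ a R v
      = ∑ a ∈ D, ∑ r ∈ R, ((ψ (-(a * r)) : Circle) : ℂ) • ρ (e r) v := by
        simp only [twSum_apply]
    _ = ∑ r ∈ R, ∑ a ∈ D, ((ψ (-(a * r)) : Circle) : ℂ) • ρ (e r) v := Finset.sum_comm
    _ = ∑ r ∈ R, (∑ a ∈ D, ((ψ (-(a * r)) : Circle) : ℂ)) • ρ (e r) v := by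
        simp only [Finset.sum_smul]
    _ = (∑ a ∈ D, ((ψ (-(a * r₀)) : Circle) : ℂ)) • ρ (e r₀) v := by
        refine Finset.sum_eq_single_of_mem r₀ hr₀R fun r hr hne => ?_
        rw [hchar_zero r hr hne, zero_smul]
    _ = (D.card : ℂ) • v := by rw [hchar_r₀, hvfix r₀ hr₀S]
    _ = D.card • v := Nat.cast_smul_eq_nsmul ℂ _ _

/-- **The easy half of Jacquet's lemma** (Bump 1997, Prop. 4.4.1 and (4.21); Bernstein–
Zelevinsky 1976, Lemma 2.33): if `v ∈ V(ψ_a)` is fixed by `S = s₁𝒪` and `ψ(a ·)|_S = 1`, then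
`P_B(a) v = 0` for every sufficiently large lattice `B ⊇ S` and every transversal of `B/S`. [cite: Bump1997, Proposition 4.4.1 (PDF p. 460)] -/
theorem twSum_eq_zero_of_mem_twistedSpan (he : ∀ x y, e (x + y) = e x * e y)
    (hsm : ∀ v : V, ∃ s : F, s ≠ 0 ∧ ∀ x ∈ ball s, ρ (e x) v = v)
    {k₀ s₁ a : F} (hs₁ : s₁ ≠ 0) (hker : ∀ x ∈ ball k₀, ψ x = 1)
    (ha : valuation F (a * s₁) ≤ valuation F k₀)
    {v : V} (hv : v ∈ twistedSpan ρ e ψ a) (hvfix : ∀ y ∈ ball s₁, ρ (e y) v = v) :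
    ∃ t₀ : F, t₀ ≠ 0 ∧ ∀ t : F, valuation F t₀ ≤ valuation F t →
      valuation F s₁ ≤ valuation F t →
      ∀ R : Finset F, IsTransversal (ball t) (ball s₁) R → twSum ρ e ψ a R v = 0 := by
  -- the inductive property
  let Q : V → Prop := fun u => ∃ t₀ : F, t₀ ≠ 0 ∧ ∀ t : F, valuation F t₀ ≤ valuation F t →
    ∃ s₀ : F, s₀ ≠ 0 ∧ ∀ s' : F, s' ≠ 0 → valuation F s' ≤ valuation F s₀ →
      valuation F s' ≤ valuation F s₁ →
      ∀ R' : Finset F, IsTransversal (ball t) (ball s') R' → twSum ρ e ψ a R' u = 0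
  have hQ : Q v := by
    refine Submodule.span_induction (p := fun u _ => Q u) ?_ ?_ ?_ ?_ hv
    · rintro _ ⟨x, w, rfl⟩
      obtain ⟨t₀, ht₀, hxt₀⟩ := exists_mem_ball x
      obtain ⟨sw, hsw, hw⟩ := hsm w
      refine ⟨t₀, ht₀, fun t ht => ⟨sw, hsw, fun s' hs' hs's hs's₁ R' hR' => ?_⟩⟩
      have hk : ∀ y ∈ ball s', ψ (a * y) = 1 := fun y hy =>
        apply_mul_eq_one_of_mem_ball hker ha (ball_mono hs's₁ hy)
      exact twSum_generator he hk hR' (ball_mono ht hxt₀) fun y hy => hw y (ball_mono hs's hy)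
    · exact ⟨1, one_ne_zero, fun t _ => ⟨1, one_ne_zero, fun s' _ _ _ R' _ => by
        rw [map_zero]⟩⟩
    · rintro u₁ u₂ - - ⟨t₁, ht₁, h₁⟩ ⟨t₂, ht₂, h₂⟩
      obtain ⟨t₀, ht₀, h01, h02⟩ := exists_valuation_ge_ge t₁ t₂ ht₂
      refine ⟨t₀, ht₀, fun t ht => ?_⟩
      obtain ⟨s₀₁, hs₀₁, k₁⟩ := h₁ t (h01.trans ht)
      obtain ⟨s₀₂, hs₀₂, k₂⟩ := h₂ t (h02.trans ht)
      obtain ⟨s₀, hs₀, hle₁, hle₂⟩ := exists_valuation_le_le s₀₁ s₀₂ hs₀₁ hs₀₂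
      refine ⟨s₀, hs₀, fun s' hs' hs's hs's₁ R' hR' => ?_⟩
      rw [map_add, k₁ s' hs' (hs's.trans hle₁) hs's₁ R' hR', k₂ s' hs' (hs's.trans hle₂) hs's₁ R' hR',
        add_zero]
    · rintro c u - ⟨t₀, ht₀, h⟩
      refine ⟨t₀, ht₀, fun t ht => ?_⟩
      obtain ⟨s₀, hs₀, k⟩ := h t ht
      refine ⟨s₀, hs₀, fun s' hs' hs's hs's₁ R' hR' => ?_⟩
      rw [map_smul, k s' hs' hs's hs's₁ R' hR', smul_zero]
  obtain ⟨t₀, ht₀, hQ⟩ := hQ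
  refine ⟨t₀, ht₀, fun t ht hst R hR => ?_⟩
  obtain ⟨s₀, hs₀, k⟩ := hQ t ht
  obtain ⟨s', hs', hs's₀, hs's₁⟩ := exists_valuation_le_le s₀ s₁ hs₀ hs₁
  have ht0 : t ≠ 0 := ne_zero_of_valuation_le hs₁ hst
  obtain ⟨R'', hR''⟩ := exists_isTransversal (B := ball s₁) (S := ball s') (ball_mono hs's₁)
    (isOpen_ball hs') (isCompact_ball s₁)
  obtain ⟨Rs, hRs⟩ := exists_isTransversal (B := ball t) (S := ball s') (ball_mono (hs's₁.trans hst))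
    (isOpen_ball hs') (isCompact_ball t)
  have h0 : twSum ρ e ψ a Rs v = 0 := k s' hs' hs's₀ hs's₁ Rs hRs
  -- compare the sums over `Rs` and over `R`
  have haS : ∀ y ∈ ball s₁, ψ (a * y) = 1 := fun y hy => apply_mul_eq_one_of_mem_ball hker ha hy
  let f : F → V := fun y => (ψ (-(a * y)) : ℂ) • ρ (e y) v
  have hf : ∀ y ∈ ball t, ∀ s ∈ ball s', f (y + s) = f y := fun y _ s hs =>
    summand_periodic he (fun z hz => haS z (ball_mono hs's₁ hz)) (fun z hz => hvfix z (ball_mono hs's₁ hz)) y hs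
  have e1 : twSum ρ e ψ a Rs v = ∑ r ∈ R, ∑ r'' ∈ R'', f (r + r'') := by
    rw [twSum_apply]
    exact hRs.sum_eq_sum_sum hR hR'' (ball_mono hst) (ball_mono hs's₁) f hf
  have e2 : ∀ r ∈ R, ∑ r'' ∈ R'', f (r + r'') = R''.card • f r := fun r _ =>
    IsTransversal.sum_eq_card_smul R'' f r fun r'' hr'' =>
      summand_periodic he haS hvfix r (hR''.mem_of_mem r'' hr'')
  rw [h0, Finset.sum_congr rfl e2, ← Finset.smul_sum] at e1
  have hcard : R''.card ≠ 0 := Finset.card_ne_zero.2 hR''.nonempty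
  have e3 : (R''.card : ℂ) • ∑ r ∈ R, f r = 0 := by
    rw [Nat.cast_smul_eq_nsmul]; exact e1.symm
  have e4 : ∑ r ∈ R, f r = 0 :=
    (smul_eq_zero.1 e3).resolve_left (Nat.cast_ne_zero.2 hcard)
  rw [twSum_apply]
  exact e4

/-- **Non-vanishing of twisted coinvariants** (Bernstein–Zelevinsky 1977, §3.2 Proposition (e)
with Remark 3.3 (b), in rank one; Bernstein–Zelevinsky 1976, §5.11–5.14; Bump 1997,
Prop. 4.4.5 and proof of Thm. 4.4.3): if the additive group of `F` acts smoothly on `V ≠ 0`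
through `e`, then for some `a ∈ F` the `ψ_a`-twisted coinvariants are non-zero, i.e.
`V(ψ_a) ≠ V`. [cite: BernsteinZelevinskyASENS1977, §3.2 Proposition (e) and Remark 3.3 (b)] -/
theorem exists_twistedSpan_ne_top (he : ∀ x y, e (x + y) = e x * e y)
    (hsm : ∀ v : V, ∃ s : F, s ≠ 0 ∧ ∀ x ∈ ball s, ρ (e x) v = v)
    (hψ : ψ.IsContinuousNontrivial) [Nontrivial V] :
    ∃ a : F, twistedSpan ρ e ψ a ≠ ⊤ := by
  classical
  by_contra hall
  push Not at hall
  obtain ⟨v, hv⟩ := exists_ne (0 : V)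
  obtain ⟨k₀, hk₀, hker, hsep⟩ := exists_level hψ
  obtain ⟨s₁, hs₁, hvfix⟩ := hsm v
  -- transversals of `t𝒪 / s₁𝒪`
  have hex : ∀ t : F, valuation F s₁ ≤ valuation F t →
      ∃ R : Finset F, IsTransversal (ball t) (ball s₁) R := fun t ht =>
    exists_isTransversal (ball_mono ht) (isOpen_ball hs₁) (isCompact_ball t)
  choose! R hR using hex
  -- membership in the dual lattice `A = (k₀/s₁)𝒪`
  have hAa : ∀ a ∈ ball (k₀ / s₁), valuation F (a * s₁) ≤ valuation F k₀ := fun a ha =>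
    (mem_ball_div_iff hs₁).1 ha
  -- the cover
  let U : F → Set F := fun t =>
    {a | valuation F s₁ ≤ valuation F t ∧ twSum ρ e ψ a (R t) v = 0}
  have hUo : ∀ t, IsOpen (U t) := by
    intro t
    by_cases hst : valuation F s₁ ≤ valuation F t
    · have ht : t ≠ 0 := ne_zero_of_valuation_le hs₁ hst
      rw [isOpen_iff_mem_nhds]
      rintro a ⟨-, ha⟩
      rw [IsValuativeTopology.mem_nhds_iff']
      have hne : valuation F (k₀ / t) ≠ 0 := (map_ne_zero _).2 (div_ne_zero hk₀ ht)
      refine ⟨Units.mk0 _ hne, fun z hz => ⟨hst, ?_⟩⟩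
      have hz' : z - a ∈ ball (k₀ / t) := mem_ball_iff.2 (le_of_lt hz)
      rw [twSum_congr_of_sub_mem hker ht (hR t hst).mem_of_mem hz']
      exact ha
    · have : U t = ∅ := Set.eq_empty_of_forall_notMem fun a ha => hst ha.1
      rw [this]
      exact isOpen_empty
  have hcov : (ball (k₀ / s₁) : Set F) ⊆ ⋃ t, U t := by
    intro a ha
    have hvmem : v ∈ twistedSpan ρ e ψ a := by rw [hall a]; exact Submodule.mem_top
    obtain ⟨t₀, ht₀, h⟩ := twSum_eq_zero_of_mem_twistedSpan he hsm hs₁ hker (hAa a ha) hvmem hvfix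
    obtain ⟨t, -, h0t, hst⟩ := exists_valuation_ge_ge t₀ s₁ hs₁
    exact Set.mem_iUnion.2 ⟨t, hst, h t h0t hst (R t) (hR t hst)⟩
  obtain ⟨T, hT⟩ := (isCompact_ball (k₀ / s₁)).elim_finite_subcover U hUo hcov
  -- a lattice of maximal size among the finitely many
  let T' := T.filter fun t => valuation F s₁ ≤ valuation F t
  have hT'ne : T'.Nonempty := by
    have h0 : (0 : F) ∈ (ball (k₀ / s₁) : Set F) := (ball (k₀ / s₁)).zero_mem
    have := hT h0
    simp only [Set.mem_iUnion, exists_prop] at this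
    obtain ⟨t, htT, ht⟩ := this
    exact ⟨t, Finset.mem_filter.2 ⟨htT, ht.1⟩⟩
  obtain ⟨tm, htm, hmax⟩ := T'.exists_max_image (fun t => valuation F t) hT'ne
  have hstm : valuation F s₁ ≤ valuation F tm := (Finset.mem_filter.1 htm).2
  have htm0 : tm ≠ 0 := ne_zero_of_valuation_le hs₁ hstm
  have hall0 : ∀ a ∈ ball (k₀ / s₁), twSum ρ e ψ a (R tm) v = 0 := by
    intro a ha
    have := hT ha
    simp only [Set.mem_iUnion, exists_prop] at this
    obtain ⟨t, htT, hst, h0⟩ := this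
    have haS : ∀ y ∈ ball s₁, ψ (a * y) = 1 := fun y hy =>
      apply_mul_eq_one_of_mem_ball hker (hAa a ha) hy
    exact twSum_eq_zero_mono he hs₁ hvfix haS hst (hmax t (Finset.mem_filter.2 ⟨htT, hst⟩))
      (hR t hst) (hR tm hstm) h0
  -- Fourier inversion
  have hle : ball (k₀ / tm) ≤ ball (k₀ / s₁) := by
    refine ball_mono ?_
    rw [map_div₀, map_div₀]
    exact div_le_div_of_nonneg_left zero_le (zero_lt_iff.2 ((map_ne_zero _).2 hs₁)) hstm
  obtain ⟨D, hD⟩ := exists_isTransversal hle (isOpen_ball (div_ne_zero hk₀ htm0))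
    (isCompact_ball (k₀ / s₁))
  have hsum := sum_twSum_eq_card_smul hs₁ htm0 hker hsep hvfix (hR tm hstm) hD
  rw [Finset.sum_eq_zero fun a ha => hall0 a (hD.mem_of_mem a ha)] at hsum
  have hcard : D.card ≠ 0 := Finset.card_ne_zero.2 hD.nonempty
  have : (D.card : ℂ) • v = 0 := by rw [Nat.cast_smul_eq_nsmul]; exact hsum.symm
  exact hv ((smul_eq_zero.1 this).resolve_left (Nat.cast_ne_zero.2 hcard))

omit [ValuativeRel F] [TopologicalSpace F] [IsNonarchimedeanLocalField F] in
/-- A one-parameter subgroup sends `0` to `1`. [folklore] -/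
lemma e_zero (he : ∀ x y, e (x + y) = e x * e y) : e 0 = 1 := by
  have h := he 0 0
  rw [add_zero] at h
  have h' : e 0 * e 0 = e 0 * 1 := by rw [mul_one]; exact h.symm
  exact mul_left_cancel h'

/-- The representation of `Multiplicative F` on `V` defined by a one-parameter subgroup `e`
and `ρ`. [folklore] -/
def compOneParam (he : ∀ x y, e (x + y) = e x * e y) : Representation ℂ (Multiplicative F) V where
  toFun x := ρ (e (Multiplicative.toAdd x))
  map_one' := by
    change ρ (e 0) = 1
    rw [e_zero he, map_one]
  map_mul' x y := by
    change ρ (e (Multiplicative.toAdd x + Multiplicative.toAdd y)) = _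
    rw [he, map_mul]

omit [ValuativeRel F] [TopologicalSpace F] [IsNonarchimedeanLocalField F] in
/-- Unfolding lemma for `compOneParam`. [folklore] -/
@[simp] lemma compOneParam_apply (he : ∀ x y, e (x + y) = e x * e y) (x : Multiplicative F) :
    compOneParam (ρ := ρ) he x = ρ (e (Multiplicative.toAdd x)) := rfl

/-- **Non-vanishing of twisted coinvariants, relative form**: if `W ≠ V` is stable under the
smooth one-parameter action `e`, then `W + V(ψ_a) ≠ V` for some `a ∈ F` — the absolute
statement `exists_twistedSpan_ne_top` applied to the quotient representation on `V / W`
(Mathlib `Representation.quotient`). (Bernstein–Zelevinsky 1977, §3.2 (e), 3.3 (b).) [cite: BernsteinZelevinskyASENS1977, §3.2 Proposition (e) and Remark 3.3 (b)] -/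
theorem exists_sup_twistedSpan_ne_top (he : ∀ x y, e (x + y) = e x * e y)
    (hsm : ∀ v : V, ∃ s : F, s ≠ 0 ∧ ∀ x ∈ ball s, ρ (e x) v = v)
    (hψ : ψ.IsContinuousNontrivial) {W : Submodule ℂ V}
    (hW : ∀ x : F, W ≤ W.comap (ρ (e x))) (hWtop : W ≠ ⊤) :
    ∃ a : F, W ⊔ twistedSpan ρ e ψ a ≠ ⊤ := by
  let σ : Representation ℂ (Multiplicative F) V := compOneParam (ρ := ρ) he
  have hWσ : ∀ g : Multiplicative F, W ≤ W.comap (σ g) := fun g => hW (Multiplicative.toAdd g)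
  let σq : Representation ℂ (Multiplicative F) (V ⧸ W) := σ.quotient W hWσ
  have hσq : ∀ (x : F) (v : V),
      σq (Multiplicative.ofAdd x) (Submodule.Quotient.mk v) = Submodule.Quotient.mk (ρ (e x) v) :=
    fun x v => rfl
  haveI : Nontrivial (V ⧸ W) := (Submodule.Quotient.nontrivial_iff).2 hWtop
  have he' : ∀ x y : F, Multiplicative.ofAdd (x + y) = Multiplicative.ofAdd x * Multiplicative.ofAdd y :=
    fun x y => rfl
  have hsm' : ∀ w : V ⧸ W, ∃ s : F, s ≠ 0 ∧ ∀ x ∈ ball s, σq (Multiplicative.ofAdd x) w = w := by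
    intro w
    induction w using Submodule.Quotient.induction_on with
    | H v =>
      obtain ⟨s, hs, h⟩ := hsm v
      exact ⟨s, hs, fun x hx => by rw [hσq, h x hx]⟩
  obtain ⟨a, ha⟩ := exists_twistedSpan_ne_top (ρ := σq) (e := fun x => Multiplicative.ofAdd x)
    (ψ := ψ) he' hsm' hψ
  refine ⟨a, fun htop => ha ?_⟩
  -- the image of `W ⊔ V(ψ_a)` in `V / W` is contained in the twisted span of the quotient
  have hle : (W ⊔ twistedSpan ρ e ψ a).map W.mkQ ≤
      twistedSpan σq (fun x => Multiplicative.ofAdd x) ψ a := by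
    rw [Submodule.map_sup, Submodule.mkQ_map_self, bot_sup_eq, twistedSpan,
      Submodule.map_span_le]
    rintro _ ⟨x, v, rfl⟩
    rw [map_sub, map_smul, Submodule.mkQ_apply, Submodule.mkQ_apply, ← hσq]
    exact sub_smul_mem_twistedSpan σq (fun x => Multiplicative.ofAdd x) ψ a x _
  rw [htop, Submodule.map_top, Submodule.range_mkQ] at hle
  exact top_le_iff.1 hle

end Rep

end TwistedJacquet

end Literature.NumberTheory.Automorphic
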